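import Summits.ResolutionOfSingularities.ResolutionOfSingularities.Theorems.FrobeniusClosingSteerBetaPolygonAlphaStarTw
import Summits.ResolutionOfSingularities.ResolutionOfSingularities.Theorems.FrobeniusClosingSteerBetaHatLawWords
import HarnessLib

/-!
# Crux `Steer` (stmt-ResolutionOfSingularities-16345), chain W4.1 — β-leaf glue S `prepDebtHatArith_of`:
# the twisted star value is a GAUGE-ORBIT invariant, so attainment + vertex theorem give the K-β1♭ slot

OURS (campaign `res-hironaka`, rung L ★L-G4, slot W4.1; seat res-L0-w41-stub-4 g7, free hand after RULINGS 207(a)/251(h) objects landed).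
Replaces the role of no printed item; NOT a statement of the manuscript under review [claim: Hironaka2017, status: under-review]; AI-produced,
weaker than expert review. Theses-free, definition-free. Words: tree `IsGaugeRepTw`/`AlphaGe`/`BetaGe`/`IsVStarTw`/`AlphaStarGeTw`
(`…BetaPolygonWords`/`…BetaPolygonGauge`), `IsHatRing`/`IsArithStage` (`…BetaHatStageWords`), `PrepAttainHat`/`VertexTheoremTwHat`/`IsPreparedTwAt`
(`…BetaHatLawWords`).

* `isVStarTw_iff_of_isGaugeRepTw` — `IsVStarTw u x y · · d α β ·` takes the same value on gauge-equivalent representatives (the twisted orbit is an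
  equivalence relation in characteristic 2: tree `isGaugeRepTw_symm/trans`, res-L0-w41-stub-1).
* `alphaStarGeTw_iff_of_isGaugeRepTw` — likewise for `AlphaStarGeTw`.
* `prepDebtHatArith_of_words` — binder for binder the body of the β-leaf word `PrepDebtHatArith` (β-leaf of record
  `Sketch-idea-1-v18-hatleaf.v184-J4K7SHCPTKFS.lean` 26f522eb5fe0cfaa §4) from the tree words `PrepAttainHat` and `VertexTheoremTwHat` taken BY NAME:
  the leaf's designed-sorry glue `prepDebtHatArith_of (hatt) (hV) : PrepDebtHatArith` becomes
  `fun S _ _ _ x y z w u f d ρ₀ => prepDebtHatArith_of_words hatt hV S x y z w u f d ρ₀`.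

[cite: CossartJannsenSaito2020, Thm. 7.16, (11.4)] [folklore]
bears_on: LADDER-RESOLUTION L ★L-G4 W4.1 (crux `Steer`, binder hK4ⁿᶜ, β-leaf glue `prepDebtHatArith_of`).
-/

noncomputable section

-- `Summit.<S>.<S>.…` duplicates the summit name by design (single-problem summit).
set_option linter.dupNamespace false

open IsLocalRing
open Summit.ResolutionOfSingularities.ResolutionOfSingularities.Theorems.SwitchingDichotomy.BetaPolygon
open Summit.ResolutionOfSingularities.ResolutionOfSingularities.Theorems.SwitchingDichotomy.BetaHat

namespace Summit.ResolutionOfSingularities.ResolutionOfSingularities.Theorems.SwitchingDichotomy.BetaPolygonMoves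

variable {S : Type} [CommRing S] [CharP S 2]

/-- **`AlphaStarGeTw` is a gauge-orbit invariant.** -/
theorem alphaStarGeTw_iff_of_isGaugeRepTw {u x y z w f z' w' f' : S} (h : IsGaugeRepTw u x y z w f z' w' f') (d : ℕ) (ρ : ℚ) :
    AlphaStarGeTw u x y z' w' d ρ f' ↔ AlphaStarGeTw u x y z w d ρ f := by
  constructor
  · rintro ⟨z₂, w₂, f₂, h₂, hα⟩
    exact ⟨z₂, w₂, f₂, isGaugeRepTw_trans h h₂, hα⟩
  · rintro ⟨z₂, w₂, f₂, h₂, hα⟩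
    exact ⟨z₂, w₂, f₂, isGaugeRepTw_trans (isGaugeRepTw_symm h) h₂, hα⟩

/-- **The twisted star value `v* = (α*, β*)` is a gauge-orbit invariant** (the orbit is an equivalence relation in characteristic `2`). -/
theorem isVStarTw_iff_of_isGaugeRepTw {u x y z w f z' w' f' : S} (h : IsGaugeRepTw u x y z w f z' w' f') (d : ℕ) (α β : ℚ) :
    IsVStarTw u x y z' w' d α β f' ↔ IsVStarTw u x y z w d α β f := by
  have key : ∀ {z w f z' w' f' : S}, IsGaugeRepTw u x y z w f z' w' f' →
      IsVStarTw u x y z' w' d α β f' → IsVStarTw u x y z w d α β f := by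
    intro z w f z' w' f' h hV
    obtain ⟨⟨z₂, w₂, f₂, h₂, hα, hβ⟩, hmaxα, hmaxβ⟩ := hV
    refine ⟨⟨z₂, w₂, f₂, isGaugeRepTw_trans h h₂, hα, hβ⟩, fun z₃ w₃ f₃ ρ h₃ hρ => ?_, fun z₃ w₃ f₃ ρ h₃ hα₃ hρ => ?_⟩
    · exact hmaxα z₃ w₃ f₃ ρ (isGaugeRepTw_trans (isGaugeRepTw_symm h) h₃) hρ
    · exact hmaxβ z₃ w₃ f₃ ρ (isGaugeRepTw_trans (isGaugeRepTw_symm h) h₃) hα₃ hρ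
  exact ⟨key h, key (isGaugeRepTw_symm h)⟩

/-- **β-leaf glue S: `PrepAttainHat` + `VertexTheoremTwHat` ⇒ `PrepDebtHatArith`** (body binder for binder): at an arithmetic stage of a hat
ring with finite twisted `α*`, the twisted star value EXISTS and is `d!`-integral — attain a prepared representative in the orbit, read its star
value by the vertex theorem, and transport it back along the orbit. -/
theorem prepDebtHatArith_of_words (hatt : PrepAttainHat) (hV : VertexTheoremTwHat)
    (S : Type) [CommRing S] [IsLocalRing S] [CharP S 2] (x y z w u f : S) (d : ℕ) (ρ₀ : ℚ)
    (hS : IsHatRing S) (hodd : Odd d) (h3 : 3 ≤ d) (hst : IsArithStage S x y z w u f d) (hfin : ¬ AlphaStarGeTw u x y z w d ρ₀ f) :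
    ∃ α β : ℚ, IsVStarTw u x y z w d α β f ∧ ∃ m n : ℕ, (d.factorial : ℚ) * α = m ∧ (d.factorial : ℚ) * β = n := by
  obtain ⟨α, β, z', w', f', hrep, hst', hprep, m, n, hm, hn⟩ := hatt S x y z w u f d ρ₀ hS hodd h3 hst hfin
  have hV' : IsVStarTw u x y z' w' d α β f' := hV S x y z' w' u f' d α β hS hodd h3 hst' hprep
  exact ⟨α, β, (isVStarTw_iff_of_isGaugeRepTw hrep d α β).mp hV', m, n, hm, hn⟩

end Summit.ResolutionOfSingularities.ResolutionOfSingularities.Theorems.SwitchingDichotomy.BetaPolygonMoves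

end
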